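import Literature.Geometry.Lorentzian.KerrSchildEnergyEstimate
import Mathlib.Analysis.ODE.ExistUnique
import Mathlib.Analysis.ODE.Gronwall
import Mathlib.Analysis.Calculus.MeanValue
import Mathlib.Analysis.InnerProductSpace.Calculus
import HarnessLib

/-!
# Uniqueness for linear transport systems on time slabs of `ℝ⁴` by the method of characteristics
# (family `gr`; infrastructure for the discharge of the named fact `KerrSchild.waveCauchyProblem`)

Let `βᵐ`, `m = 1, 2, 3`, be `C¹` functions on `ℝ⁴ = ℝ × ℝ³` forming a bounded drift vector, and let
`ω : ℝ⁴ → F` (`F` a real normed space) be differentiable on the open time slab `{|t| < T}` and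
satisfy there the differential inequality

  `‖∂_t ω − βᵐ ∂_m ω‖ ≤ C ‖ω‖`

with a continuous weight `C` — e.g. a solution of a linear transport system
`∂_t ω = βᵐ ∂_m ω + L ω` with continuous matrix coefficient `L`. If `ω` vanishes on the initial
slice `{t = 0}`, then `ω` vanishes on the whole slab (`eq_zero_of_transport_of_data_zero`).

Proof (method of characteristics; Courant–Hilbert, *Methods of Mathematical Physics* II, Ch. II
§1–2; John, *PDE*, Ch. 1 §§4–5; Evans, *PDE*, §3.2): through every point `(t, x⃗)` of the slab
passes the characteristic curve `s ↦ (s, y(s))`, `ẏ = −β(s, y)`, `y(t) = x⃗`, which exists on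
`[−T', T'] ∋ 0, t` by the Picard–Lindelöf theorem (Mathlib's `IsPicardLindelof`, on a ball so large
that the bounded drift cannot leave it; the Lipschitz constant is a bound for the continuous
spatial derivative of `β` on a compact cylinder); along it `f(s) = ω(s, y(s))` satisfies
`f' = (∂_t ω − βᵐ∂_m ω)(s, y(s))`, so `‖f'‖ ≤ K ‖f‖` with `K` the maximum of `C` on the compact
curve, and `f(0) = 0`; Grönwall's inequality (Mathlib's
`eq_zero_of_abs_deriv_le_mul_abs_self_of_eq_zero_right`, forward and, after a time reflection,
backward) gives `f ≡ 0`, in particular `ω(t, x⃗) = f(t) = 0`.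

This is used to propagate the constraint `curl q⃗ = 0` of the first-order reduction of the wave
equation on Kerr–Schild backgrounds (`KerrSchildSymmHypReduction.lean`), where no integrability of
the solution is available and energy-method uniqueness therefore does not apply directly.

Everything is proved; no named fact and no `sorry` is introduced.

## References

* F. John, *Partial differential equations*, 4th ed., Springer 1982, Ch. 1, §§4–5 (linear and
  quasi-linear first-order equations, characteristics). [John1982]
* L. C. Evans, *Partial Differential Equations*, 2nd ed., AMS 2010, §3.2 (characteristics).
  [Evans2010]
-/

noncomputable section

open Set Filter Metric
open scoped Topology NNReal

namespace Literature.Geometry.Lorentzian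

namespace E4

variable {F : Type*} [NormedAddCommGroup F] [NormedSpace ℝ F]

/-! ### The drift vector -/

/-- The drift vector `β⃗(z) ∈ ℝ³` with components `βᵐ(z)`. [cite: John1982, Ch. 1 §5] -/
def driftVec (β : Fin 3 → E4 → ℝ) (z : E4) : E3 := WithLp.toLp 2 fun m ↦ β m z

/-- Components of the drift vector. [cite: John1982, Ch. 1 §5] -/
@[simp] theorem driftVec_apply (β : Fin 3 → E4 → ℝ) (z : E4) (m : Fin 3) : driftVec β z m = β m z :=
  rfl

/-- The drift vector is `C^n` when its components are. [folklore] -/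
theorem contDiff_driftVec {β : Fin 3 → E4 → ℝ} {n : WithTop ℕ∞} (hβ : ∀ m, ContDiff ℝ n (β m)) :
    ContDiff ℝ n (driftVec β) :=
  contDiff_euclidean.2 fun m ↦ by simpa using hβ m

/-- The embedded vector `(0, v) = ∑_m v_m ∂_{m+1}`. [folklore] -/
theorem spaceEmbed_eq_sum (v : E3) : spaceEmbed v = ∑ m : Fin 3, v m • basisVector m.succ := by
  ext i
  rw [spaceEmbed_apply, WithLp.ofLp_sum, Finset.sum_apply]
  refine Fin.cases ?_ (fun j ↦ ?_) i
  · simp [basisVector, Fin.succ_ne_zero]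
  · simp only [ofTimeSpace_apply_succ, WithLp.ofLp_smul, Pi.smul_apply, smul_eq_mul]
    rw [Finset.sum_eq_single j]
    · simp [basisVector]
    · intro m _ hm
      simp [basisVector, Fin.succ_inj, Ne.symm hm]
    · simp

/-- The derivative along `∂_t + (0, −β⃗)` is `∂_t ω − ∑_m βᵐ ∂_m ω`. [cite: John1982, Ch. 1 §5] -/
theorem fderiv_apply_basisVector_add_spaceEmbed_neg_driftVec (β : Fin 3 → E4 → ℝ) (ω : E4 → F)
    (z : E4) :
    fderiv ℝ ω z (basisVector 0 + spaceEmbed (-driftVec β z)) =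
      fderiv ℝ ω z (basisVector 0) - ∑ m : Fin 3, β m z • fderiv ℝ ω z (basisVector m.succ) := by
  rw [map_neg, spaceEmbed_eq_sum, map_add, map_neg, map_sum]
  simp only [map_smul, driftVec_apply]
  abel

/-! ### Characteristics -/

/-- **Existence of characteristics**: for `C¹` bounded drift components `βᵐ` (`‖β⃗‖ ≤ b`), every
`(t, x⃗)` with `|t| < T'` there is a curve `y : ℝ → ℝ³` with `y(t) = x⃗`
and `ẏ(s) = −β⃗(s, y(s))` for all `s ∈ (−T', T')` (Picard–Lindelöf on the ball of radius `2bT'`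
about `x⃗`, with the Lipschitz constant a bound of the spatial derivative of `β⃗` on the compact
cylinder `[−T', T'] × B̄(x⃗, 2bT')`). [cite: John1982, Ch. 1 §5] -/
theorem exists_characteristic {β : Fin 3 → E4 → ℝ} {b : ℝ} (hβ : ∀ m, ContDiff ℝ 1 (β m))
    (hb : ∀ z, ‖driftVec β z‖ ≤ b) {T' t : ℝ} (ht : |t| < T') (x : E3) :
    ∃ y : ℝ → E3, y t = x ∧ ∀ s ∈ Ioo (-T') T', HasDerivAt y (-driftVec β (ofTimeSpace s (y s))) s := by
  have hT' : 0 < T' := lt_of_le_of_lt (abs_nonneg t) ht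
  have hb0 : 0 ≤ b := (norm_nonneg _).trans (hb 0)
  -- the vector field
  set f : ℝ → E3 → E3 := fun s y ↦ -driftVec β (ofTimeSpace s y) with hf
  have hdrift : ContDiff ℝ 1 (driftVec β) := contDiff_driftVec hβ
  have hdcont : Continuous (fderiv ℝ (driftVec β)) := hdrift.continuous_fderiv one_ne_zero
  -- radius and the compact cylinder
  set a : ℝ := b * (2 * T') with ha
  have ha0 : 0 ≤ a := by positivity
  obtain ⟨M, hM⟩ : ∃ M, ∀ p ∈ (Icc (-T') T') ×ˢ closedBall x a,
      ‖fderiv ℝ (driftVec β) (ofTimeSpace p.1 p.2)‖ ≤ M := by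
    have hK : IsCompact ((Icc (-T') T') ×ˢ closedBall x a) :=
      isCompact_Icc.prod (isCompact_closedBall x a)
    have hc : Continuous fun p : ℝ × E3 ↦ ‖fderiv ℝ (driftVec β) (ofTimeSpace p.1 p.2)‖ :=
      continuous_norm.comp (hdcont.comp continuous_ofTimeSpace_uncurry)
    obtain ⟨M, hM⟩ := hK.exists_bound_of_continuousOn hc.continuousOn
    exact ⟨M, fun p hp ↦ (le_abs_self _).trans ((Real.norm_eq_abs _).symm.le.trans (hM p hp))⟩
  have hM0 : 0 ≤ M := (norm_nonneg _).trans (hM (0, x) ⟨by constructor <;> linarith, mem_closedBall_self ha0⟩)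
  -- the Lipschitz constant
  set K : ℝ := M * ‖(spaceEmbed : E3 →L[ℝ] E4)‖ with hK
  have hK0 : 0 ≤ K := mul_nonneg hM0 (norm_nonneg _)
  -- derivative of the field in `y`
  have hfd : ∀ s y, HasFDerivAt (f s) (-((fderiv ℝ (driftVec β) (ofTimeSpace s y)).comp spaceEmbed)) y := by
    intro s y
    have h1 : HasFDerivAt (driftVec β) (fderiv ℝ (driftVec β) (ofTimeSpace s y)) (ofTimeSpace s y) :=
      ((hdrift.differentiable one_ne_zero) _).hasFDerivAt
    exact (h1.comp y (hasFDerivAt_ofTimeSpace s y)).neg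
  -- Picard–Lindelöf data
  have ht₀ : t ∈ Icc (-T') T' := ⟨by linarith [neg_abs_le t], by linarith [le_abs_self t]⟩
  have hPL : IsPicardLindelof f (⟨t, ht₀⟩ : Icc (-T') T') x ⟨a, ha0⟩ 0 ⟨b, hb0⟩ ⟨K, hK0⟩ := by
    refine ⟨fun s hs ↦ ?_, fun y _ ↦ ?_, fun s _ y _ ↦ ?_, ?_⟩
    · refine (convex_closedBall x a).lipschitzOnWith_of_nnnorm_fderiv_le
        (fun y _ ↦ (hfd s y).differentiableAt) fun y hy ↦ ?_
      rw [← NNReal.coe_le_coe, coe_nnnorm, (hfd s y).fderiv, norm_neg]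
      exact (ContinuousLinearMap.opNorm_comp_le _ _).trans
        (mul_le_mul_of_nonneg_right (hM (s, y) ⟨hs, hy⟩) (norm_nonneg _))
    · exact ((hdrift.continuous.comp (continuous_ofTimeSpace_uncurry.comp
        (continuous_id.prodMk continuous_const))).neg).continuousOn
    · change ‖-driftVec β (ofTimeSpace s y)‖ ≤ b
      rw [norm_neg]
      exact hb _
    · simp only [NNReal.coe_zero, sub_zero]
      have hmax : max (T' - t) (t - -T') ≤ 2 * T' := by
        apply max_le <;> linarith [neg_abs_le t, le_abs_self t]
      calc b * max (T' - t) (t - -T') ≤ b * (2 * T') := mul_le_mul_of_nonneg_left hmax hb0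
        _ = a := rfl
  obtain ⟨y, hy0, hy⟩ := hPL.exists_eq_forall_mem_Icc_hasDerivWithinAt₀
  refine ⟨y, hy0, fun s hs ↦ ?_⟩
  exact (hy s (Ioo_subset_Icc_self hs)).hasDerivAt (Icc_mem_nhds hs.1 hs.2)

/-! ### Uniqueness by characteristics and Grönwall -/

/-- **Uniqueness for linear transport systems on a time slab by the method of characteristics.**
Let `βᵐ ∈ C¹(ℝ⁴)` be the components of a bounded drift, `ω : ℝ⁴ → F` differentiable at the points of
the open slab `{|x⁰| < T}` with `‖∂_t ω − ∑_m βᵐ ∂_m ω‖ ≤ C ‖ω‖` there for a continuous weight `C`,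
and `ω = 0` on `{x⁰ = 0}`. Then `ω = 0` on the slab. [cite: John1982, Ch. 1 §§4–5; Evans2010, §3.2] -/
theorem eq_zero_of_transport_of_data_zero {β : Fin 3 → E4 → ℝ} {ω : E4 → F} {C : E4 → ℝ} {T b : ℝ}
    (hβ : ∀ m, ContDiff ℝ 1 (β m)) (hb : ∀ z, ‖driftVec β z‖ ≤ b)
    (hω : ∀ x : E4, |x 0| < T → DifferentiableAt ℝ ω x) (hC : Continuous C)
    (heq : ∀ x : E4, |x 0| < T →
      ‖fderiv ℝ ω x (basisVector 0) - ∑ m : Fin 3, β m x • fderiv ℝ ω x (basisVector m.succ)‖ ≤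
        C x * ‖ω x‖)
    (h0 : ∀ y : E3, ω (ofTimeSpace 0 y) = 0) (x : E4) (hx : |x 0| < T) : ω x = 0 := by
  -- the characteristic through `x`, on `(-T', T')` with `|x⁰| < T' < T`
  set t := x 0 with htdef
  set T' := (|t| + T) / 2 with hT'
  have htT' : |t| < T' := by rw [hT']; linarith
  have hT'T : T' < T := by rw [hT']; linarith
  have hT'0 : 0 < T' := lt_of_le_of_lt (abs_nonneg t) htT'
  obtain ⟨y, hyt, hy⟩ := exists_characteristic hβ hb htT' (spatial x)
  set γ : ℝ → E4 := fun s ↦ ofTimeSpace s (y s) with hγ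
  have hγt : γ t = x := by
    simp only [hγ]
    rw [hyt]
    exact ofTimeSpace_time_spatial x
  have hslab : ∀ s ∈ Ioo (-T') T', |γ s 0| < T := fun s hs ↦ by
    simp only [hγ, ofTimeSpace_apply_zero]
    rw [abs_lt]; constructor <;> linarith [hs.1, hs.2]
  -- derivative of the curve and of `g = ω ∘ γ`
  have hγd : ∀ s ∈ Ioo (-T') T',
      HasDerivAt γ (basisVector 0 + spaceEmbed (-driftVec β (γ s))) s := by
    intro s hs
    have h1 : HasDerivAt (fun s : ℝ ↦ s • basisVector 0) (basisVector 0) s := by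
      simpa using (hasDerivAt_id s).smul_const (basisVector 0)
    have h2 : HasDerivAt (fun s ↦ spaceEmbed (y s)) (spaceEmbed (-driftVec β (γ s))) s :=
      spaceEmbed.hasFDerivAt.comp_hasDerivAt s (hy s hs)
    have key : HasDerivAt (fun s : ℝ ↦ s • basisVector 0 + spaceEmbed (y s))
        (basisVector 0 + spaceEmbed (-driftVec β (γ s))) s := h1.add h2
    exact key.congr_of_eventuallyEq (Eventually.of_forall fun r ↦ ofTimeSpace_eq_smul_add' r (y r))
  set g : ℝ → F := fun s ↦ ω (γ s) with hg
  set g' : ℝ → F := fun s ↦ fderiv ℝ ω (γ s) (basisVector 0) -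
    ∑ m : Fin 3, β m (γ s) • fderiv ℝ ω (γ s) (basisVector m.succ) with hg'
  have hgd : ∀ s ∈ Ioo (-T') T', HasDerivAt g (g' s) s := by
    intro s hs
    have h := (hω _ (hslab s hs)).hasFDerivAt.comp_hasDerivAt s (hγd s hs)
    rw [fderiv_apply_basisVector_add_spaceEmbed_neg_driftVec] at h
    exact h
  have hgc : ContinuousOn g (Ioo (-T') T') := fun s hs ↦
    (hgd s hs).continuousAt.continuousWithinAt
  -- a uniform constant along the compact part of the curve
  obtain ⟨K, hK⟩ : ∃ K, ∀ s ∈ Icc (-|t|) (|t|), C (γ s) ≤ K := by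
    have hγc : ContinuousOn γ (Icc (-|t|) (|t|)) := fun s hs ↦
      (hγd s ⟨by linarith [hs.1], by linarith [hs.2]⟩).continuousAt.continuousWithinAt
    obtain ⟨K, hK⟩ := isCompact_Icc.exists_bound_of_continuousOn (hC.comp_continuousOn hγc)
    exact ⟨K, fun s hs ↦ (le_abs_self _).trans ((Real.norm_eq_abs _).symm.le.trans (hK s hs))⟩
  have hbound : ∀ s ∈ Icc (-|t|) (|t|), ‖g' s‖ ≤ K * ‖g s‖ := by
    intro s hs
    have hs' : |γ s 0| < T := hslab s ⟨by linarith [hs.1], by linarith [hs.2]⟩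
    exact (heq _ hs').trans (mul_le_mul_of_nonneg_right (hK s hs) (norm_nonneg _))
  have hg0 : g 0 = 0 := h0 (y 0)
  -- Grönwall, forward and backward from `0`
  have hIoo : ∀ s, |s| ≤ |t| → s ∈ Ioo (-T') T' := fun s hs ↦
    ⟨by linarith [neg_abs_le s], by linarith [le_abs_self s]⟩
  have hforward : ∀ s ∈ Icc 0 (|t|), g s = 0 := by
    have hcont : ContinuousOn g (Icc 0 (|t|)) :=
      hgc.mono fun r hr ↦ hIoo r (by rw [abs_of_nonneg hr.1]; exact hr.2)
    refine eq_zero_of_abs_deriv_le_mul_abs_self_of_eq_zero_right (K := K) (f' := g') hcont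
      (fun s hs ↦ ?_) hg0 fun s hs ↦ ?_
    · exact (hgd s (hIoo s (by rw [abs_of_nonneg hs.1]; exact hs.2.le))).hasDerivWithinAt
    · exact hbound s ⟨by linarith [hs.1, abs_nonneg t], hs.2.le⟩
  have hbackward : ∀ s ∈ Icc 0 (|t|), g (-s) = 0 := by
    refine eq_zero_of_abs_deriv_le_mul_abs_self_of_eq_zero_right (K := K) (f := fun s ↦ g (-s))
      (f' := fun s ↦ -g' (-s)) (fun s hs ↦ ?_) (fun s hs ↦ ?_) (by simpa using hg0) fun s hs ↦ ?_
    · have hm : -s ∈ Ioo (-T') T' := hIoo (-s) (by rw [abs_neg, abs_of_nonneg hs.1]; exact hs.2)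
      exact ((hgd (-s) hm).continuousAt.comp (continuous_neg.continuousAt)).continuousWithinAt
    · have hm : -s ∈ Ioo (-T') T' := hIoo (-s) (by rw [abs_neg, abs_of_nonneg hs.1]; exact hs.2.le)
      have h := (hgd (-s) hm).scomp s (hasDerivAt_neg s)
      have h' : HasDerivAt (fun s ↦ g (-s)) (-g' (-s)) s := by
        simpa [Function.comp_def] using h
      exact h'.hasDerivWithinAt
    · rw [norm_neg]
      exact hbound (-s) ⟨by linarith [hs.2], by linarith [hs.1, abs_nonneg t]⟩
  -- conclude at `s = t`
  rw [← hγt]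
  change g t = 0
  rcases le_or_gt 0 t with ht0 | ht0
  · exact hforward t ⟨ht0, le_abs_self t⟩
  · have h := hbackward (-t) ⟨by linarith, by rw [abs_of_neg ht0]⟩
    simpa using h

end E4

end Literature.Geometry.Lorentzian

end
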